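import Literature.Computability.Complexity.PairingMachines
import Literature.Computability.Complexity.CoinTruncation
import HarnessLib

/-!
# The truncation map `⟨x, y⟩ ↦ ⟨x, y↾p(|x|)⟩` as a total string function in `FP`

The witness-length bound `|y| ≤ p(|x|)` of an `NP` language (`NP = polyExists P`,
`Nondeterministic.lean`; Arora–Barak 2009, Def. 2.1) is not enforced by its `P`-relation `L'`.
Wherever a proof needs a polynomial-time predicate that *only* accepts in-range witnesses —
Cook–Reckhow's Prop. 1.4 (⟸) ("the length test built into the proof system made from an `NP`
relation", `MetaComplexity/ProofSystemsProofs.lean`) and the closure of `NP` under Karp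
reductions (`ReductionsProofs.lean`) — one precomposes the decider of `L'` with the total
**truncation map**

  `truncPairFn p z = boolPair x (y.take (p |x|))`,   `(x, y) = boolUnpair z`,

which is the identity on in-range pairs and sends every string to an in-range pair.

No machine is built here: `truncPairFn p = truncSndFn p ∘ rePair`, where
`truncSndFn p ⟨u, r⟩ = ⟨u, r ↾ p(|u|)⟩` is the coin-truncation map of `CoinTruncation.lean`
(specified on well-formed pairs only) and `rePair z = ⟨(boolUnpair z).1, (boolUnpair z).2⟩` is
the re-pairing normaliser of `PairingMachines.lean` (which makes the composite a prescribed
total function of `z`); both are in `FP`, and `FP` is closed under composition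
(`PolyTimeComputable.comp_holds`).

## References

* S. Arora, B. Barak, *Computational Complexity: A Modern Approach*, CUP 2009, Def. 2.1 (the
  bound `|u| ≤ p(|x|)`), §1.3 (polynomials are time constructible).
* S. A. Cook, R. A. Reckhow, *The relative efficiency of propositional proof systems*,
  J. Symbolic Logic 44 (1979), §1; S. Cook, P. Nguyen, *Logical Foundations of Proof
  Complexity*, CUP 2010, Thm. VII.1.4 (⟸) (the length test in the proof system built from an
  NP relation).
-/

namespace Literature.Computability.Complexity

open _root_.Computability

/-- **The truncation map** `truncPairFn p z = boolPair x (y.take (p |x|))`,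
`(x, y) = boolUnpair z`: a total string function realising the witness-length test of an `NP`
presentation. [Arora–Barak 2009, Def. 2.1; Cook–Reckhow 1979, §1]
[cite: AroraBarakCC2009, Def. 2.1] -/
noncomputable def truncPairFn (p : Polynomial ℕ) (z : List Bool) : List Bool :=
  boolPair (boolUnpair z).1 ((boolUnpair z).2.take (p.eval (boolUnpair z).1.length))

/-- On a well-formed pair: `truncPairFn p (boolPair x y) = boolPair x (y.take (p |x|))`.
[Arora–Barak 2009, Def. 2.1] [cite: AroraBarakCC2009, Def. 2.1] -/
@[simp] theorem truncPairFn_boolPair (p : Polynomial ℕ) (x y : List Bool) :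
    truncPairFn p (boolPair x y) = boolPair x (y.take (p.eval x.length)) := by
  simp [truncPairFn]

/-- Truncation is the identity on in-range pairs. [Arora–Barak 2009, Def. 2.1]
[cite: AroraBarakCC2009, Def. 2.1] -/
theorem truncPairFn_boolPair_of_le (p : Polynomial ℕ) {x y : List Bool}
    (h : y.length ≤ p.eval x.length) : truncPairFn p (boolPair x y) = boolPair x y := by
  rw [truncPairFn_boolPair, List.take_of_length_le h]

/-- Truncating an already truncated witness changes nothing. [folklore] -/
theorem truncPairFn_boolPair_take (p : Polynomial ℕ) (x y : List Bool) :
    truncPairFn p (boolPair x (y.take (p.eval x.length))) = truncPairFn p (boolPair x y) := by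
  simp [List.take_take]

/-- The output of the truncation map is an in-range pair: its witness component has length
`≤ p |x|`. [Arora–Barak 2009, Def. 2.1] [cite: AroraBarakCC2009, Def. 2.1] -/
theorem truncPairFn_eq_boolPair (p : Polynomial ℕ) (z : List Bool) :
    ∃ x y : List Bool, y.length ≤ p.eval x.length ∧ truncPairFn p z = boolPair x y :=
  ⟨(boolUnpair z).1, (boolUnpair z).2.take (p.eval (boolUnpair z).1.length),
    List.length_take_le _ _, rfl⟩

/-- `truncPairFn p = truncSndFn p ∘ rePair` (re-pair, then truncate the second component).
[folklore] -/
theorem truncPairFn_eq_truncSndFn_comp_rePair (p : Polynomial ℕ) :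
    truncPairFn p = truncSndFn p ∘ rePair := by
  funext z
  simp [truncPairFn, rePair, truncSndFn_boolPair]

/-- **The truncation map is in `FP`** — the machine content of "the length test
`|y| ≤ p(|x|)` is polynomial-time" in the `NP` normal form: composition of `rePair ∈ FP`
(`PairingMachines.lean`) and `truncSndFn p ∈ FP` (`CoinTruncation.lean`) by
`PolyTimeComputable.comp_holds`. [Arora–Barak 2009, Def. 2.1, §1.3; Cook–Nguyen 2010,
Thm. VII.1.4 (⟸)] [cite: AroraBarakCC2009, Def. 2.1] -/
theorem truncPairFn_mem_FP (p : Polynomial ℕ) : truncPairFn p ∈ FP := by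
  rw [truncPairFn_eq_truncSndFn_comp_rePair]
  exact PolyTimeComputable.comp_holds (truncSndFn_mem_FP p) rePair_mem_FP

end Literature.Computability.Complexity
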